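import Summits.BirchSwinnertonDyer.BirchSwinnertonDyer.Theorems.KolyvaginRoadThreeLevelData
import Summits.BirchSwinnertonDyer.BirchSwinnertonDyer.Theorems.KolyvaginRoadThreeTowerForm
import HarnessLib

/-!
# Route `KolyvaginRoadThree` — crux `ZhangSharpFrameAtThree` ⟹ TOWER POINT FORM modulo Gross 1991 §3 only
# (`--supports stmt-BirchSwinnertonDyer-19153`, helper; cell `bsd-stepL`, seat `bsd-stepL-koly`)

THEOREM ONLY. zhang3-p1's `KolyCert.towerCertificates_of_zhangSharpFrameAtThree` (p420076) with its hypothesis shape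
`hKD` (Kolyvagin–Heegner data exist at every square-free inert level) DISCHARGED by
`kolyvaginRoadThree_towerData_of_grossCM` (`Theorems/KolyvaginRoadThreeLevelData.lean`) from the two named facts of
Gross 1991 §3 (`phi_heegnerPointOfConductor_mem_range_map_ringClassField`, `exists_generator_ringClassGalOver`;
`Literature/…/HeegnerPointsOfConductorRationality.lean`). With the unconditional converse
`KolyCert.zhangSharpFrameAtThree_of_towerCertificates` (p418676): the deciding crux of route `KolyvaginRoadThree` is
EQUIVALENT to its tower point form «at every Manin-good conductor-1 frame ∃ n ∈ Λ₃ ∃ tower d m (m ∣ n), 3 ∤ P(n) in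
E(K[n])» modulo two published CM facts — the exact shape of a derived-point certificate (koly `KOLY-WITNESS.md`).
Nothing is asserted about the crux; no class of atom O2@3 moves (PARTITION: O2@3 × A1 — types-the-object-of; closes:
none). References: [GrossLMS1991] §3–§4; [McCallumLMS1991] Cor. 4.5.
-/

noncomputable section

open scoped Classical

namespace Summit.BirchSwinnertonDyer.BirchSwinnertonDyer.Theorems

open WeierstrassCurve NumberField Literature.NumberTheory.EllipticCurves
  Literature.NumberTheory.EllipticCurves.ModularForms

/-- **Crux ⟹ tower point form, modulo the two published CM facts only** (zhang3-p1's
`KolyCert.towerCertificates_of_zhangSharpFrameAtThree`, p420076, with its hypothesis shape `hKD` DISCHARGED by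
`kolyvaginRoadThree_towerData_of_grossCM`): granted Gross 1991 §3 (`y(n) ∈ E(K[n])`; `G_ℓ` cyclic) at every
`(N, W, K)`, the deciding crux `ZhangSharpFrameAtThree` gives at every Manin-good conductor-1 frame on its binders a
level `n ∈ Λ₃` and a TOWER of Kolyvagin–Heegner data `d m (m ∣ n)` with `3 ∤ P(n)` in `E(K[n])`. With the converse
`KolyCert.zhangSharpFrameAtThree_of_towerCertificates` (p418676, unconditional) the crux is EQUIVALENT to its tower
point form modulo these two named facts — the exact shape a derived-point certificate delivers (koly g9
`KOLY-WITNESS.md`: `3 ∤ P(2)` at 8475b1 ∕ 28725a1 ⊗ ℚ(√−11), …). Nothing is asserted about the crux.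
[cite: GrossLMS1991, §3 (pp. 238–239) and §4 (4.1)] [cite: McCallumLMS1991, Cor. 4.5] -/
theorem towerCertificates_of_zhangSharpFrameAtThree_of_grossCM
    (h1 : ∀ (N : ℕ) [NeZero N] (W : WeierstrassCurve ℚ) (K : Type) [Field K] [NumberField K],
      phi_heegnerPointOfConductor_mem_range_map_ringClassField N W K)
    (h2 : ∀ (K : Type) [Field K] [NumberField K], exists_generator_ringClassGalOver K)
    (hZ : Summit.BirchSwinnertonDyer.BirchSwinnertonDyer.Theses.KolyvaginRoadThree.ZhangSharpFrameAtThree) :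
    ∀ (W : WeierstrassCurve ℚ) [W.IsElliptic] [W.IsGloballyMinimal] [NeZero (W.conductorNorm ℤ)]
      (K : Type) [Field K] [NumberField K]
      (Dt : ModularParametrizationData W (W.conductorNorm ℤ)) (β : ℤ) (ι : K →+* ℂ),
      W.HasMultiplicativeReductionAtPrime 3 → Rank1Residual.Surj W 3 → Rank1Residual.Ram W 3 →
      ¬ 3 ∣ W.tamagawaProduct → IsImaginaryQuadratic K →
      SatisfiesHeegnerHypothesis (W.conductorNorm ℤ) K → NumberField.discr K ≠ -3 →
      (4 * (W.conductorNorm ℤ : ℤ)) ∣ β ^ 2 - NumberField.discr K → ¬ (3 : ℤ) ∣ Dt.c →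
      ∃ (n : ℕ) (d : (m : ℕ) → m ∣ n → KolyvaginHeegnerData Dt β ι m),
        KolyvaginDescent.KolSupp (Zhang2014.IsKolyvaginPrime (W.conductorNorm ℤ) W K 3) n ∧
          ¬ Summit.BirchSwinnertonDyer.Rank1Residual.X11b.Three.Koly.PDiv (d n dvd_rfl) 3 1 :=
  Summit.BirchSwinnertonDyer.Rank1Residual.X11b.Three.KolyCert.towerCertificates_of_zhangSharpFrameAtThree
    (kolyvaginRoadThree_towerData_of_grossCM h1 h2) hZ

end Summit.BirchSwinnertonDyer.BirchSwinnertonDyer.Theorems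

end
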